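import Summits.ResolutionOfSingularities.ResolutionOfSingularities.Theorems.EquisingularLiftEquisingularLiftNatNDModelRoundEndChart
import Summits.ResolutionOfSingularities.ResolutionOfSingularities.Theorems.EquisingularLiftEquisingularLiftNatNDRoundModelSplit
import HarnessLib

/-!
# [OURS · L1 W4.5(b) · EL♮(3)] (B4α2) `modelEnd` BY NAME — `…NatNDModelRoundEnd`: at a WON fan a toric stage is regular and the reduced closure `T̂` of the
# strict transform is regular at every point over the origin (SPEC v9–v11 §13.14 brick (B4α2); desk WIDTH TABLE D1 2026-08-28T14:38:46Z row iso-w1)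

OURS · L1 W4.5(b) · EL♮(3) stmt-ResolutionOfSingularities-20148 (parent EL♮ stmt-…-20038) · counted 0 · AI-written (res-L1-w45b-iso-w1 g0, WIDTH seat on
D-0157 DOOR 1), weaker than expert review; nothing of [Hironaka2017] asserted; no statement of the manuscript; dim-3 char-p resolution is CP 2008/2009 in
print — this is a piece of OUR kernel-own version.  Sorry-free, def-free, standard axioms, no instance, no notation.
`--supports stmt-ResolutionOfSingularities-20148 --as helper`: the brick closes BY NAME against the text owner's port `…NatNDRoundModelSplit` (`ND.ToricStage`,
`ND.ModelEnd`, `ND.toricChartHom`; idea-1 PORT DRAFT v4 2fd04eaad88dd372 = SPEC v11 a5493418881edb4c §13.14) with the SPEC binder order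
`modelEnd (n) (k) [Field k] [IsAlgClosed k] (g) (hg : LocalND g) : ModelEnd n k g`, and feeds `modelRound := modelRound_of_toricStage n k (playFacts n) (modelInit n k)
(modelStep n k) (modelEnd n k)` → `roundAtNDFrameLN`/`roundAtNDFrame` → `ndInv_round` → `nd_rung_local` → the registered 4th CHILD stub
`stub_elnat_three_isolated_newtonNondegenerate`.  The mathematics is `ND.modelEnd_of_charts` (✓ p643018 `…NatNDModelRoundEndChart`): this file only unpacks the (TS1) chart
clause and `IsClosed T` from `ToricStage` and identifies the toric chart map `toricChartHom n k B` on variables (`t_l ↦ ∏ᵢ yᵢ^{B i l}`, `aeval_X`).  `k = k̄` IS used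
(crit-3's witness 2026-08-28T14:21:05Z: over `ℚ` the brick is false as the tree's local Newton-nondegeneracy quantifies over k-rational torus points).
-/

set_option linter.dupNamespace false

noncomputable section

open CategoryTheory CategoryTheory.Limits AlgebraicGeometry TopologicalSpace Topology
open MvPolynomial
open Literature.AlgebraicGeometry.Resolution
open AlgebraicGeometry.Scheme.IdealSheafData

namespace Summit.ResolutionOfSingularities.ResolutionOfSingularities.Cruxes.EquisingularLiftNat.Sections.ND

open Summit.ResolutionOfSingularities.ResolutionOfSingularities.Cruxes.EquisingularLiftNat.Sections

section RoundModel

variable (n : ℕ) (k : Type) [Field k]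

/-- **(B4α2) `modelEnd` — END of the model round.**  For a convenient, locally Newton-nondegenerate `g` over an algebraically closed field: at every toric stage
`ToricStage n k g Φ F φ E T` whose fan `Φ` is WON for `table g`, the stage `F` is a regular scheme and the reduced closed subscheme on `closure T` is regular at
every point lying over the origin of `𝔸ⁿ_k`.  Proof = `modelEnd_of_charts` on the (TS1) chart clause and `IsClosed T`.  [OURS · L1 W4.5b · (B4α2) by name · iso-w1] -/
theorem modelEnd [IsAlgClosed k] (g : MvPolynomial (Fin n) k) (hg : LocalND g) : ModelEnd n k g := by
  intro Φ F φ E T hst hW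
  obtain ⟨-, hcharts, -, -, hT, -⟩ := hst
  refine modelEnd_of_charts g hg Φ F φ T (fun x => ?_) hT hW
  obtain ⟨σ, hσ, B, c, hc, hx, hσB, hdet, hcφ, -, -, hcT⟩ := hcharts x
  exact ⟨σ, hσ, B, c, hc, hx, hσB, hdet, ⟨toricChartHom n k B, fun l => by simp [toricChartHom], hcφ⟩, hcT⟩

end RoundModel

end Summit.ResolutionOfSingularities.ResolutionOfSingularities.Cruxes.EquisingularLiftNat.Sections.ND

end
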